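/-
Copyright (c) 2026 the pub-hodgecm-mathlib formalisation cell (harness21).  Prover seat hodgecm-mathlib-LH4-p04 (g8), req620 Track A «(D-RAM) FOUR-FRAME» squad
(STAGE-1b, row (2) of the piece `f_{T₊}`, the (β₂) road; dealer∕pen LH4-plan (g13) WORD #108 (4) ∕ WORD #112 (1), PEN #13: «(S4) β₂ ASSEMBLY onto `betaT2.letter.v1`,
LH4-p04 lineage»; chair LH4-r01 (g9) junction note 14:10:09Z), 2026-09-04.
-/
import Summits.HodgeConjecture.HodgeConjecture.Theorems.F0P3cDyRamLevelsTypeTwoLiterals   -- ★ p859549 (this lineage, (C2-lev-lit)): brings ★ p857702 `exists_oppositeLiteral_wild`, ★ frame literal `exists_isLocalNormPair_coe_eq_of_frame` + its κ, ★ signed pair + exhaustion, ★ `coe_mem_unitaryGroupOfForm_over`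
import Summits.HodgeConjecture.HodgeConjecture.Theorems.F0P3cDyRamCleanSgnModelForm       -- ★ (LH4-p05 (g8)): `cleanMinusFixCount_conj_eq`; brings ★ p859223 (LH4-p13 (g8)) `transvPlusFixCount_conj_eq`, ★ DEFS leaves №5 `cleanMinusFixCount ∕ mcOfRecord`, №3 `mstarOfRecord`, U2G `transvPlusFixCount`
import HarnessLib

/-!
# Crux `H413`, line LH4 «(D-RAM) FOUR-FRAME» — STAGE-1b, row (2), the (β₂) road: (S4-lit) «β₂ OF RECORD ⟸ β₂ AT THE TWO LITERAL SHAPES OF SOCKET (C″)»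
# `betaT2.letter.v1` (cd9aa77b) VERBATIM ⟸ `betaT2lit.letter.v1`: the clean-sign offset `T₊ − T−′` agrees at `ι_w t_h = endoGL (ι_w γ_H.1, ι_w γ_H.2)` and `ι_w t_a = P₁·endoGL (γ₁, ι_w γ_H.2)·P₁⁻¹`

Cell `hodgecm-mathlib` (D-0151), FLOOR 0, crux item H413 = `stmt-HodgeConjecture-24833`, route of record `HCCMUnconditional`; squad F0∕P3c∕LH4; lane
`--supports stmt-HodgeConjecture-24833 --as helper` (count-neutral; pays NO tier-0 row).  THEOREMS ONLY (no `def`, no instance, no notation, no `sorry`).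

THE POINT.  The (β₂) letter of the piece `f_{T₊}` — `betaT2.letter.v1` (cd9aa77b), the `hCS₂` binder of ★ p860151 `hDelta_ofRecord` and the `hβ₂` binder of ★ p860783 (LH4-p06 (g7))
`hSideRows_transvPlus_ofRecord (hβ₂) (hC)` (chair LH4-r01 (g9) 14:10:09Z: byte-for-byte after whitespace canon), hence the last letter of the tier-0 row `stub_hside_transvPlus` besides
LH4-p07 (g9)'s socket `levelsCensusC` — speaks of ABSTRACT norm matches: «near `1 ∈ H_v`, for every `G`-regular `γ_H` whose w-block is rootless in `L_w` and every pair of matches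
`δ₊` (`κ = +1`), `δ₋` (`κ = −1`):  `T₊(ι_w δ₊) − T−′(ι_w δ₊) = T₊(ι_w δ₋) − T−′(ι_w δ₋)`» (`T₊ = transvPlusFixCount σ_w ϖ d (d%2) m*`, `T−′ = cleanMinusFixCount σ_w ϖ d (d%2) m* m_c`).
Every producer of the (β₂) road, however — (S-1) ★ p860690, (S-2), (β₂-H) ★ p860765 ∕ ★ p860795 ∕ ★ p860839 (LH4-p09 (g9)), the order forms ★ p859421 ∕ ★ p859485 ∕ ★ p859229, the
value-set letters ★ p860208 ∕ p860233 — prices the two counts at the two LITERAL SHAPES of socket (C″): the hyperbolic block element `endoGL (ι_w γ_H.1, ι_w γ_H.2)` (frame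
`(Φ₃)_w = block((Φ₂)_w, 1)` on the nose) and the anisotropic one `P₁·endoGL (γ₁, ι_w γ_H.2)·P₁⁻¹` (`formCongr σ_w P₁ (Φ₃)_w = block(diag dg, η)`, `η` a non-norm unit,
`γ₁ ∈ U(diag dg)`, `χ_{γ₁} = χ_{g_w}`; ★ p857702 `exists_oppositeLiteral_wild`).  THIS FILE is the δ-to-literal step of the (S4) assembly, ONCE AND FOR ALL:
* §1 `transvPlusFixCount_conj_eq_self ∕ cleanMinusFixCount_conj_eq_self` — valued-field letters: both labelled counts are invariant under conjugation by `P ∈ U(σ, antidiag₃)`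
  (★ p859223 `transvPlusFixCount_conj_eq` ∕ ★ `cleanMinusFixCount_conj_eq` at the model `formCongr σ P Φ₃ = Φ₃`; the labelled twin of ★ (C2-lev-class) `ncard_typeZero_fixed_levels_conj_eq`).
* §2 `transvPlusFixCount_eq_of_isConj ∕ cleanMinusFixCount_eq_of_isConj` — at the CM place: `IsConj δ δ′ → T₊(ι_w δ′) = T₊(ι_w δ)`, `T−′` likewise (`ι_w` a homomorphism into
  `U(σ_w, (Φ₃)_w)`, ★ `coe_mem_unitaryGroupOfForm_over`).
* §3 HEAD `hbeta2_of_literals (hLit : ‹betaT2lit.letter.v1›) : ‹betaT2.letter.v1 VERBATIM›` — per place: `V := V_A ∩ V_lit` (★ p857702's neighbourhood ∩ the literal letter's);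
  a match of sign `+1` is `G_v`-conjugate to the FRAME LITERAL `t_h` (★ `exists_isLocalNormPair_coe_eq_of_frame` at `A := 1`, `κ(t_h) = (1, θ)_v = 1` ★
  `finKappaAt_eq_hilbertSymbol_of_coe_eq_of_frame`), a match of sign `−1` to ★ p857702's `t_a` — by the signed pair's exhaustion clauses (★
  `exists_signedPair_finsum_delta_mul_classOrbitalIntegral_eq_mul_sub`, as in ★ p859496 §3 ∕ ★ p860334 §3) — and §2 moves the four counts onto the literals, where `hLit` applies.
  The two unitary-membership antecedents of `hLit` (`ι_w t_h`, `ι_w t_a ∈ U(σ_w, (Φ₃)_w)`) are discharged here from the matches (free for the literal letter's producers).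
THE NEW LETTER `betaT2lit.letter.v1` (the `hLit` binder's type; text `F0/P3c/LH4/LH4-p04/g8/betaT2lit.letter.v1.LH4p04g8.lean.txt`) is the (S4) assembly's remaining target: a
statement about two explicit matrices of `GL₃(L_w)` per near-`1` type-(2) `γ_H`, with NO norm pair, NO `κ`, NO measure and NO Hecke character in it — to be paid by the per-cell
road ((β₂-S) on GENERIC cone cells ∕ (β₂-H) on SPECIFIC ones, summed through the labelled order form).  It is a HYPOTHESIS here — nothing asserted.
HONEST LABEL.  Count-neutral reduction; (β₂) stays a HYPOTHESIS of the T₊ chain until `betaT2lit.letter.v1` is ★; `HC_CM` is proved only modulo the 7 printed citations (2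
remaining named inputs: hLiu418 = `stmt-HodgeConjecture-24832`, h413 = `stmt-HodgeConjecture-24833`) until rung 0 closes.
## References
* [Rogawski1990] J. D. Rogawski, *Automorphic Representations of Unitary Groups in Three Variables*, Ann. of Math. Stud. 123 (1990): §4.3 (4.3.1)–(4.3.2) p. 43; §4.9 Prop. 4.9.1 (a)(b) p. 55, Lemma 4.9.3 p. 56.
* [Kottwitz1986BaseChangeUnits] R. E. Kottwitz, *Base change for unit elements of Hecke algebras*, Compositio Math. 60 (1986): §1 pp. 240–241.
* [LanglandsShelstad1987] R. P. Langlands, D. Shelstad, *On the definition of transfer factors*, Math. Ann. 278 (1987): §1.3.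
* [Jacobowitz1962] R. Jacobowitz, *Hermitian forms over local fields*, Amer. J. Math. 84 (1962): §4, §7 Thm. 7.1.
-/

set_option autoImplicit false

noncomputable section
namespace Summit.HodgeConjecture.HodgeConjecture.Cruxes.H413.F0P3cDyRamCleanSgnDiffTypeTwoOfLiterals

open MeasureTheory Measure NumberField IsDedekindDomain Topology Filter
open Literature.NumberTheory.Automorphic Literature.NumberTheory.Automorphic.UnitaryGroup Literature.NumberTheory.Automorphic.IntegralReduction
open Literature.NumberTheory.Rogawski1990 Literature.NumberTheory.GaloisRepresentations
open Literature.NumberTheory.Automorphic.UnitaryThreeFourFrame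
open Literature.NumberTheory.Automorphic.UnitaryLatticeTree Literature.NumberTheory.Automorphic.HermitianLattice
open Literature.NumberTheory.QuadraticForms
open Summit.HodgeConjecture.HodgeConjecture.Cruxes.H413.F0P3cDyRamFourFrameHSideDefs
open Summit.HodgeConjecture.HodgeConjecture.Cruxes.H413.F0P3cDyRamFourFramePieces
open Summit.HodgeConjecture.HodgeConjecture.Cruxes.H413.F0P3cDyRamFourFrameCensusDefs
open Summit.HodgeConjecture.HodgeConjecture.Cruxes.H413.F0P3cDyRamStageOneBDefs
open Summit.HodgeConjecture.HodgeConjecture.Cruxes.H413.F0P3cDyRamLevelsTypeTwoDictionary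
open Summit.HodgeConjecture.HodgeConjecture.Cruxes.H413.F0P3cDyRamLabelCountDiagonalModel
open Summit.HodgeConjecture.HodgeConjecture.Cruxes.H413.F0P3cDyRamCleanSgnModelForm
open Summit.HodgeConjecture.HodgeConjecture.Cruxes.H413.F0P3cDyRamProfilePiecesProps (uniformizer_facts coe_mem_unitaryGroupOfForm_over)
open Summit.HodgeConjecture.HodgeConjecture.Cruxes.H413
open scoped Matrix MatrixGroups Classical Valued WithZero

/-! ## §1 Valued-field letters: both labelled counts are invariant under unitary conjugation -/

section Valued

variable {K : Type} [Field K] [Valued K ℤᵐ⁰]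

/-- **`T₊` IS INVARIANT UNDER UNITARY CONJUGATION**: for `P ∈ U(σ, antidiag₃)` and any `T ∈ GL₃(K)`, `transvPlusFixCount σ ϖ d ℓ m (P·T·P⁻¹) = transvPlusFixCount σ ϖ d ℓ m T`
(★ p859223 `transvPlusFixCount_conj_eq` in the model `formCongr σ P Φ₃ = Φ₃`; the RHS is the count's own definition). [cite: Kottwitz1986BaseChangeUnits, §1 pp. 240–241]
[cite: Rogawski1990, §4.9 Prop. 4.9.1 (b) p. 55, Lemma 4.9.3 p. 56] -/
theorem transvPlusFixCount_conj_eq_self (σ : K →+* K) (ϖ : K) (d ℓ m : ℕ) {P : GL (Fin 3) K} (T : GL (Fin 3) K)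
    (hP : P ∈ unitaryGroupOfForm σ ((StdForm.antidiagonal 3).over K)) :
    transvPlusFixCount σ ϖ d ℓ m (P * T * P⁻¹) = transvPlusFixCount σ ϖ d ℓ m T := by
  rw [transvPlusFixCount_conj_eq σ ϖ (mem_unitaryGroupOfForm_iff.1 hP) rfl d ℓ m]
  rfl

/-- **`T−′` IS INVARIANT UNDER UNITARY CONJUGATION**: for `P ∈ U(σ, antidiag₃)` and any `T`, `cleanMinusFixCount σ ϖ d ℓ m mc (P·T·P⁻¹) = cleanMinusFixCount σ ϖ d ℓ m mc T`
(★ `cleanMinusFixCount_conj_eq` in the model `formCongr σ P Φ₃ = Φ₃`). [cite: Kottwitz1986BaseChangeUnits, §1 pp. 240–241] [cite: Rogawski1990, §4.9 Prop. 4.9.1 (b) p. 55, Lemma 4.9.3 p. 56] -/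
theorem cleanMinusFixCount_conj_eq_self (σ : K →+* K) (ϖ : K) (d ℓ m mc : ℕ) {P : GL (Fin 3) K} (T : GL (Fin 3) K)
    (hP : P ∈ unitaryGroupOfForm σ ((StdForm.antidiagonal 3).over K)) :
    cleanMinusFixCount σ ϖ d ℓ m mc (P * T * P⁻¹) = cleanMinusFixCount σ ϖ d ℓ m mc T := by
  rw [cleanMinusFixCount_conj_eq σ ϖ (mem_unitaryGroupOfForm_iff.1 hP) rfl d ℓ m mc]
  rfl

end Valued

/-! ## §2 At the CM place: both labelled counts are class functions on `G_v` -/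

section CM

variable (L : Type) [Field L] [NumberField L] [IsCMField L] {v : HeightOneSpectrum (𝓞 ↥(maximalRealSubfield L))} (w : UnitaryGroup.PlacesOver L v)
  (hw : IsCMField.complexConj L • w.1 = w.1) (ϖ : (w.1.adicCompletion L))

/-- **`T₊ ∘ ι_w` IS A CLASS FUNCTION ON `G_v`**: `IsConj δ δ′ → transvPlusFixCount σ_w ϖ d ℓ m (ι_w δ′) = transvPlusFixCount σ_w ϖ d ℓ m (ι_w δ)` (`δ′ = cδc⁻¹`, `ι_w c ∈ U(σ_w, (Φ₃)_w)`
★ `coe_mem_unitaryGroupOfForm_over`, §1). [cite: Kottwitz1986BaseChangeUnits, §1 pp. 240–241] [cite: Rogawski1990, §4.3 (4.3.1) p. 43; §4.9 Prop. 4.9.1 (b) p. 55] -/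
theorem transvPlusFixCount_eq_of_isConj (d ℓ m : ℕ) {δ δ' : ((UnitaryGroup.cmDatum L 3 (Matrix.of fun i j : Fin 3 => if i.val + j.val + 1 = 3 then (1 : L) else 0)).Local v)} (hconj : IsConj δ δ') :
    transvPlusFixCount (galAdicCompletionMap (L := L) (IsCMField.complexConj L) hw) ϖ d ℓ m ((localNonsplitEquiv (IsCMField.complexConj L) (Matrix.of fun i j : Fin 3 => if i.val + j.val + 1 = 3 then (1 : L) else 0) (IsCMField.complexConj_ne_one L) w hw δ' :
        ↥(unitaryGroupOfForm (galAdicCompletionMap (L := L) (IsCMField.complexConj L) hw) (placeForm (Matrix.of fun i j : Fin 3 => if i.val + j.val + 1 = 3 then (1 : L) else 0) w.1))) : GL (Fin 3) (w.1.adicCompletion L)) =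
      transvPlusFixCount (galAdicCompletionMap (L := L) (IsCMField.complexConj L) hw) ϖ d ℓ m ((localNonsplitEquiv (IsCMField.complexConj L) (Matrix.of fun i j : Fin 3 => if i.val + j.val + 1 = 3 then (1 : L) else 0) (IsCMField.complexConj_ne_one L) w hw δ :
        ↥(unitaryGroupOfForm (galAdicCompletionMap (L := L) (IsCMField.complexConj L) hw) (placeForm (Matrix.of fun i j : Fin 3 => if i.val + j.val + 1 = 3 then (1 : L) else 0) w.1))) : GL (Fin 3) (w.1.adicCompletion L)) := by
  let ι : ((UnitaryGroup.cmDatum L 3 (Matrix.of fun i j : Fin 3 => if i.val + j.val + 1 = 3 then (1 : L) else 0)).Local v) →* GL (Fin 3) (w.1.adicCompletion L) :=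
    (Subgroup.subtype _).comp (localNonsplitEquiv (IsCMField.complexConj L) (Matrix.of fun i j : Fin 3 => if i.val + j.val + 1 = 3 then (1 : L) else 0) (IsCMField.complexConj_ne_one L) w hw).toMulEquiv.toMonoidHom
  have hιe : ∀ x, ι x = ((localNonsplitEquiv (IsCMField.complexConj L) (Matrix.of fun i j : Fin 3 => if i.val + j.val + 1 = 3 then (1 : L) else 0) (IsCMField.complexConj_ne_one L) w hw x :
        ↥(unitaryGroupOfForm (galAdicCompletionMap (L := L) (IsCMField.complexConj L) hw) (placeForm (Matrix.of fun i j : Fin 3 => if i.val + j.val + 1 = 3 then (1 : L) else 0) w.1))) : GL (Fin 3) (w.1.adicCompletion L)) := fun _ => rfl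
  obtain ⟨c, hc⟩ := isConj_iff.1 hconj
  have hδ' : ι δ' = ι c * ι δ * (ι c)⁻¹ := by rw [← hc, map_mul, map_mul, map_inv]
  have hcU : ι c ∈ unitaryGroupOfForm (galAdicCompletionMap (L := L) (IsCMField.complexConj L) hw) ((StdForm.antidiagonal 3).over (w.1.adicCompletion L)) := by
    rw [hιe]; exact coe_mem_unitaryGroupOfForm_over L w hw c
  rw [← hιe δ', ← hιe δ, hδ']
  exact transvPlusFixCount_conj_eq_self (galAdicCompletionMap (L := L) (IsCMField.complexConj L) hw) ϖ d ℓ m (ι δ) hcU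

/-- **`T−′ ∘ ι_w` IS A CLASS FUNCTION ON `G_v`**: `IsConj δ δ′ → cleanMinusFixCount σ_w ϖ d ℓ m mc (ι_w δ′) = cleanMinusFixCount σ_w ϖ d ℓ m mc (ι_w δ)`.
[cite: Kottwitz1986BaseChangeUnits, §1 pp. 240–241] [cite: Rogawski1990, §4.3 (4.3.1) p. 43; §4.9 Prop. 4.9.1 (b) p. 55] -/
theorem cleanMinusFixCount_eq_of_isConj (d ℓ m mc : ℕ) {δ δ' : ((UnitaryGroup.cmDatum L 3 (Matrix.of fun i j : Fin 3 => if i.val + j.val + 1 = 3 then (1 : L) else 0)).Local v)} (hconj : IsConj δ δ') :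
    cleanMinusFixCount (galAdicCompletionMap (L := L) (IsCMField.complexConj L) hw) ϖ d ℓ m mc ((localNonsplitEquiv (IsCMField.complexConj L) (Matrix.of fun i j : Fin 3 => if i.val + j.val + 1 = 3 then (1 : L) else 0) (IsCMField.complexConj_ne_one L) w hw δ' :
        ↥(unitaryGroupOfForm (galAdicCompletionMap (L := L) (IsCMField.complexConj L) hw) (placeForm (Matrix.of fun i j : Fin 3 => if i.val + j.val + 1 = 3 then (1 : L) else 0) w.1))) : GL (Fin 3) (w.1.adicCompletion L)) =
      cleanMinusFixCount (galAdicCompletionMap (L := L) (IsCMField.complexConj L) hw) ϖ d ℓ m mc ((localNonsplitEquiv (IsCMField.complexConj L) (Matrix.of fun i j : Fin 3 => if i.val + j.val + 1 = 3 then (1 : L) else 0) (IsCMField.complexConj_ne_one L) w hw δ :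
        ↥(unitaryGroupOfForm (galAdicCompletionMap (L := L) (IsCMField.complexConj L) hw) (placeForm (Matrix.of fun i j : Fin 3 => if i.val + j.val + 1 = 3 then (1 : L) else 0) w.1))) : GL (Fin 3) (w.1.adicCompletion L)) := by
  let ι : ((UnitaryGroup.cmDatum L 3 (Matrix.of fun i j : Fin 3 => if i.val + j.val + 1 = 3 then (1 : L) else 0)).Local v) →* GL (Fin 3) (w.1.adicCompletion L) :=
    (Subgroup.subtype _).comp (localNonsplitEquiv (IsCMField.complexConj L) (Matrix.of fun i j : Fin 3 => if i.val + j.val + 1 = 3 then (1 : L) else 0) (IsCMField.complexConj_ne_one L) w hw).toMulEquiv.toMonoidHom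
  have hιe : ∀ x, ι x = ((localNonsplitEquiv (IsCMField.complexConj L) (Matrix.of fun i j : Fin 3 => if i.val + j.val + 1 = 3 then (1 : L) else 0) (IsCMField.complexConj_ne_one L) w hw x :
        ↥(unitaryGroupOfForm (galAdicCompletionMap (L := L) (IsCMField.complexConj L) hw) (placeForm (Matrix.of fun i j : Fin 3 => if i.val + j.val + 1 = 3 then (1 : L) else 0) w.1))) : GL (Fin 3) (w.1.adicCompletion L)) := fun _ => rfl
  obtain ⟨c, hc⟩ := isConj_iff.1 hconj
  have hδ' : ι δ' = ι c * ι δ * (ι c)⁻¹ := by rw [← hc, map_mul, map_mul, map_inv]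
  have hcU : ι c ∈ unitaryGroupOfForm (galAdicCompletionMap (L := L) (IsCMField.complexConj L) hw) ((StdForm.antidiagonal 3).over (w.1.adicCompletion L)) := by
    rw [hιe]; exact coe_mem_unitaryGroupOfForm_over L w hw c
  rw [← hιe δ', ← hιe δ, hδ']
  exact cleanMinusFixCount_conj_eq_self (galAdicCompletionMap (L := L) (IsCMField.complexConj L) hw) ϖ d ℓ m mc (ι δ) hcU

end CM

/-! ## §3 HEAD — the (β₂) letter of record from the literal letter -/

set_option maxHeartbeats 400000 in
-- budget only: two statement-heavy letter texts (the f2316d92 place prefix twice, socket (C″)'s literal shapes); default 200000 times out at `whnf` of the statement.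
/-- **(S4-lit) β₂ OF RECORD ⟸ β₂ AT THE TWO LITERALS.**  `hLit` = `betaT2lit.letter.v1`: near `1 ∈ H_v`, for every `G`-regular type-(2) `γ_H` and every anisotropic literal datum
`(P₁, dg, η, γ₁)` of ★ p857702's shape, the clean-sign offset `T₊ − T−′` (levels `(d%2, m*)`, square level `m_c`) takes the same value at `endoGL (ι_w γ_H.1, ι_w γ_H.2)` and at
`P₁·endoGL (γ₁, ι_w γ_H.2)·P₁⁻¹`.  Conclusion = `betaT2.letter.v1` (cd9aa77b) VERBATIM (= ★ p860783's `hβ₂` ∕ ★ p860151's `hCS₂` binder).  Proof: §3 of the module doc.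
`hLit` is a HYPOTHESIS — nothing asserted. [cite: Rogawski1990, §4.3 (4.3.1)–(4.3.2) p. 43; §4.9 Prop. 4.9.1 (a)(b) p. 55, Lemma 4.9.3 p. 56] [cite: LanglandsShelstad1987, §1.3] [cite: Jacobowitz1962, §7 Thm. 7.1] -/
theorem hbeta2_of_literals
    (hLit :
      ∀ (L : Type) [Field L] [NumberField L] [IsCMField L]
        {v : HeightOneSpectrum (𝓞 ↥(maximalRealSubfield L))} (w : UnitaryGroup.PlacesOver L v)
        (hw : IsCMField.complexConj L • w.1 = w.1) (_he : v.asIdeal.ramificationIdx' w.1.asIdeal ≠ 1)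
        (_h2 : ¬ IsUnit (2 : 𝒪[w.1.adicCompletion L]))
        (ϖ : (w.1.adicCompletion L)) (_hϖ : Valued.v ϖ = WithZero.exp (-1 : ℤ)) (d tE : ℕ) (_hD : IsRamifiedQuadraticDatum (galAdicCompletionMap (L := L) (IsCMField.complexConj L) hw) ϖ d tE)
        [Fintype (Valued.ResidueField (w.1.adicCompletion L))],
        ∃ V ∈ 𝓝 (1 : ((UnitaryGroup.cmDatum L 2 (Matrix.of fun i j : Fin 2 => if i.val + j.val + 1 = 2 then (1 : L) else 0)).Local v × (UnitaryGroup.cmDatum L 1 (Matrix.of fun i j : Fin 1 => if i.val + j.val + 1 = 1 then (1 : L) else 0)).Local v)), ∀ γH ∈ V, IsLocalGRegular L v γH →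
          ¬ (∃ x : (w.1.adicCompletion L), ((((((γH).1.val : GL (Fin 2) (UnitaryGroup.LocalRing L v)).val.map (Pi.evalRingHom (fun w' : UnitaryGroup.PlacesOver L v => w'.1.adicCompletion L) w)))).charpoly).IsRoot x) →
          ∀ (P₁ : GL (Fin 3) (w.1.adicCompletion L)) (dg : Fin 2 → (w.1.adicCompletion L)) (η : (w.1.adicCompletion L)) (γ₁ : GL (Fin 2) (w.1.adicCompletion L)),
            endoGL (((localNonsplitEquiv (IsCMField.complexConj L) (Matrix.of fun i j : Fin 2 => if i.val + j.val + 1 = 2 then (1 : L) else 0) (IsCMField.complexConj_ne_one L) w hw γH.1 :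
              ↥(unitaryGroupOfForm (galAdicCompletionMap (L := L) (IsCMField.complexConj L) hw) (placeForm (Matrix.of fun i j : Fin 2 => if i.val + j.val + 1 = 2 then (1 : L) else 0) w.1))) : GL (Fin 2) (w.1.adicCompletion L)),
            ((localNonsplitEquiv (IsCMField.complexConj L) (Matrix.of fun i j : Fin 1 => if i.val + j.val + 1 = 1 then (1 : L) else 0) (IsCMField.complexConj_ne_one L) w hw γH.2 :
              ↥(unitaryGroupOfForm (galAdicCompletionMap (L := L) (IsCMField.complexConj L) hw) (placeForm (Matrix.of fun i j : Fin 1 => if i.val + j.val + 1 = 1 then (1 : L) else 0) w.1))) : GL (Fin 1) (w.1.adicCompletion L))) ∈ unitaryGroupOfForm (galAdicCompletionMap (L := L) (IsCMField.complexConj L) hw) (placeForm (Matrix.of fun i j : Fin 3 => if i.val + j.val + 1 = 3 then (1 : L) else 0) w.1) →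
            P₁ * endoGL (γ₁, ((localNonsplitEquiv (IsCMField.complexConj L) (Matrix.of fun i j : Fin 1 => if i.val + j.val + 1 = 1 then (1 : L) else 0) (IsCMField.complexConj_ne_one L) w hw γH.2 :
              ↥(unitaryGroupOfForm (galAdicCompletionMap (L := L) (IsCMField.complexConj L) hw) (placeForm (Matrix.of fun i j : Fin 1 => if i.val + j.val + 1 = 1 then (1 : L) else 0) w.1))) : GL (Fin 1) (w.1.adicCompletion L))) * P₁⁻¹ ∈ unitaryGroupOfForm (galAdicCompletionMap (L := L) (IsCMField.complexConj L) hw) (placeForm (Matrix.of fun i j : Fin 3 => if i.val + j.val + 1 = 3 then (1 : L) else 0) w.1) →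
            formCongr (galAdicCompletionMap (L := L) (IsCMField.complexConj L) hw) P₁ (placeForm (Matrix.of fun i j : Fin 3 => if i.val + j.val + 1 = 3 then (1 : L) else 0) w.1) =
              (!![(Matrix.diagonal dg) 0 0, 0, (Matrix.diagonal dg) 0 1; 0, η, 0; (Matrix.diagonal dg) 1 0, 0, (Matrix.diagonal dg) 1 1] : Matrix (Fin 3) (Fin 3) (w.1.adicCompletion L)) →
            (∀ i, Valued.v (dg i) = 1) → (∀ i, (galAdicCompletionMap (L := L) (IsCMField.complexConj L) hw) (dg i) = dg i) →
            (galAdicCompletionMap (L := L) (IsCMField.complexConj L) hw) η = η → Valued.v η = 1 → (¬ ∃ t : (w.1.adicCompletion L), t * (galAdicCompletionMap (L := L) (IsCMField.complexConj L) hw) t = η) →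
            γ₁ ∈ unitaryGroupOfForm (galAdicCompletionMap (L := L) (IsCMField.complexConj L) hw) (Matrix.diagonal dg) →
            (γ₁ : Matrix (Fin 2) (Fin 2) (w.1.adicCompletion L)).charpoly = (((((γH).1.val : GL (Fin 2) (UnitaryGroup.LocalRing L v)).val.map (Pi.evalRingHom (fun w' : UnitaryGroup.PlacesOver L v => w'.1.adicCompletion L) w)))).charpoly →
          (transvPlusFixCount (galAdicCompletionMap (L := L) (IsCMField.complexConj L) hw) ϖ d (d % 2) (mstarOfRecord d) (endoGL (((localNonsplitEquiv (IsCMField.complexConj L) (Matrix.of fun i j : Fin 2 => if i.val + j.val + 1 = 2 then (1 : L) else 0) (IsCMField.complexConj_ne_one L) w hw γH.1 :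
              ↥(unitaryGroupOfForm (galAdicCompletionMap (L := L) (IsCMField.complexConj L) hw) (placeForm (Matrix.of fun i j : Fin 2 => if i.val + j.val + 1 = 2 then (1 : L) else 0) w.1))) : GL (Fin 2) (w.1.adicCompletion L)),
            ((localNonsplitEquiv (IsCMField.complexConj L) (Matrix.of fun i j : Fin 1 => if i.val + j.val + 1 = 1 then (1 : L) else 0) (IsCMField.complexConj_ne_one L) w hw γH.2 :
              ↥(unitaryGroupOfForm (galAdicCompletionMap (L := L) (IsCMField.complexConj L) hw) (placeForm (Matrix.of fun i j : Fin 1 => if i.val + j.val + 1 = 1 then (1 : L) else 0) w.1))) : GL (Fin 1) (w.1.adicCompletion L)))) : ℤ) -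
            (cleanMinusFixCount (galAdicCompletionMap (L := L) (IsCMField.complexConj L) hw) ϖ d (d % 2) (mstarOfRecord d) (mcOfRecord d) (endoGL (((localNonsplitEquiv (IsCMField.complexConj L) (Matrix.of fun i j : Fin 2 => if i.val + j.val + 1 = 2 then (1 : L) else 0) (IsCMField.complexConj_ne_one L) w hw γH.1 :
              ↥(unitaryGroupOfForm (galAdicCompletionMap (L := L) (IsCMField.complexConj L) hw) (placeForm (Matrix.of fun i j : Fin 2 => if i.val + j.val + 1 = 2 then (1 : L) else 0) w.1))) : GL (Fin 2) (w.1.adicCompletion L)),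
            ((localNonsplitEquiv (IsCMField.complexConj L) (Matrix.of fun i j : Fin 1 => if i.val + j.val + 1 = 1 then (1 : L) else 0) (IsCMField.complexConj_ne_one L) w hw γH.2 :
              ↥(unitaryGroupOfForm (galAdicCompletionMap (L := L) (IsCMField.complexConj L) hw) (placeForm (Matrix.of fun i j : Fin 1 => if i.val + j.val + 1 = 1 then (1 : L) else 0) w.1))) : GL (Fin 1) (w.1.adicCompletion L)))) : ℤ) =
          (transvPlusFixCount (galAdicCompletionMap (L := L) (IsCMField.complexConj L) hw) ϖ d (d % 2) (mstarOfRecord d) (P₁ * endoGL (γ₁, ((localNonsplitEquiv (IsCMField.complexConj L) (Matrix.of fun i j : Fin 1 => if i.val + j.val + 1 = 1 then (1 : L) else 0) (IsCMField.complexConj_ne_one L) w hw γH.2 :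
              ↥(unitaryGroupOfForm (galAdicCompletionMap (L := L) (IsCMField.complexConj L) hw) (placeForm (Matrix.of fun i j : Fin 1 => if i.val + j.val + 1 = 1 then (1 : L) else 0) w.1))) : GL (Fin 1) (w.1.adicCompletion L))) * P₁⁻¹) : ℤ) -
            (cleanMinusFixCount (galAdicCompletionMap (L := L) (IsCMField.complexConj L) hw) ϖ d (d % 2) (mstarOfRecord d) (mcOfRecord d) (P₁ * endoGL (γ₁, ((localNonsplitEquiv (IsCMField.complexConj L) (Matrix.of fun i j : Fin 1 => if i.val + j.val + 1 = 1 then (1 : L) else 0) (IsCMField.complexConj_ne_one L) w hw γH.2 :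
              ↥(unitaryGroupOfForm (galAdicCompletionMap (L := L) (IsCMField.complexConj L) hw) (placeForm (Matrix.of fun i j : Fin 1 => if i.val + j.val + 1 = 1 then (1 : L) else 0) w.1))) : GL (Fin 1) (w.1.adicCompletion L))) * P₁⁻¹) : ℤ)) :
      ∀ (L : Type) [Field L] [NumberField L] [IsCMField L]
        {v : HeightOneSpectrum (𝓞 ↥(maximalRealSubfield L))} (w : UnitaryGroup.PlacesOver L v)
        (hw : IsCMField.complexConj L • w.1 = w.1) (_he : v.asIdeal.ramificationIdx' w.1.asIdeal ≠ 1)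
        (_h2 : ¬ IsUnit (2 : 𝒪[w.1.adicCompletion L]))
        (ϖ : (w.1.adicCompletion L)) (_hϖ : Valued.v ϖ = WithZero.exp (-1 : ℤ)) (d tE : ℕ) (_hD : IsRamifiedQuadraticDatum (galAdicCompletionMap (L := L) (IsCMField.complexConj L) hw) ϖ d tE)
        [Fintype (Valued.ResidueField (w.1.adicCompletion L))] (δ : (w.1.adicCompletion L)) (_hδ : (galAdicCompletionMap (L := L) (IsCMField.complexConj L) hw) δ = -δ) (_hδ0 : δ ≠ 0)
        (μ : HeckeCharacter L) (_hμu : μ.IsUnitary)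
        (_hμω : ∀ x : ideleGroup ↥(maximalRealSubfield L), μ (AdeleRing.ideleBaseChange ↥(maximalRealSubfield L) L x) = quadraticHeckeCharCM L x)
        [MeasurableSpace ((UnitaryGroup.cmDatum L 3 (Matrix.of fun i j : Fin 3 => if i.val + j.val + 1 = 3 then (1 : L) else 0)).Local v)] [BorelSpace ((UnitaryGroup.cmDatum L 3 (Matrix.of fun i j : Fin 3 => if i.val + j.val + 1 = 3 then (1 : L) else 0)).Local v)]
        [∀ γ : ((UnitaryGroup.cmDatum L 3 (Matrix.of fun i j : Fin 3 => if i.val + j.val + 1 = 3 then (1 : L) else 0)).Local v), MeasurableSpace (((UnitaryGroup.cmDatum L 3 (Matrix.of fun i j : Fin 3 => if i.val + j.val + 1 = 3 then (1 : L) else 0)).Local v) ⧸ Subgroup.centralizer ({γ} : Set ((UnitaryGroup.cmDatum L 3 (Matrix.of fun i j : Fin 3 => if i.val + j.val + 1 = 3 then (1 : L) else 0)).Local v)))]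
        [∀ γ : ((UnitaryGroup.cmDatum L 3 (Matrix.of fun i j : Fin 3 => if i.val + j.val + 1 = 3 then (1 : L) else 0)).Local v), BorelSpace (((UnitaryGroup.cmDatum L 3 (Matrix.of fun i j : Fin 3 => if i.val + j.val + 1 = 3 then (1 : L) else 0)).Local v) ⧸ Subgroup.centralizer ({γ} : Set ((UnitaryGroup.cmDatum L 3 (Matrix.of fun i j : Fin 3 => if i.val + j.val + 1 = 3 then (1 : L) else 0)).Local v)))]
        [MeasurableSpace ((UnitaryGroup.cmDatum L 2 (Matrix.of fun i j : Fin 2 => if i.val + j.val + 1 = 2 then (1 : L) else 0)).Local v × (UnitaryGroup.cmDatum L 1 (Matrix.of fun i j : Fin 1 => if i.val + j.val + 1 = 1 then (1 : L) else 0)).Local v)] [BorelSpace ((UnitaryGroup.cmDatum L 2 (Matrix.of fun i j : Fin 2 => if i.val + j.val + 1 = 2 then (1 : L) else 0)).Local v × (UnitaryGroup.cmDatum L 1 (Matrix.of fun i j : Fin 1 => if i.val + j.val + 1 = 1 then (1 : L) else 0)).Local v)]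
        [∀ a : ((UnitaryGroup.cmDatum L 2 (Matrix.of fun i j : Fin 2 => if i.val + j.val + 1 = 2 then (1 : L) else 0)).Local v × (UnitaryGroup.cmDatum L 1 (Matrix.of fun i j : Fin 1 => if i.val + j.val + 1 = 1 then (1 : L) else 0)).Local v), MeasurableSpace (((UnitaryGroup.cmDatum L 2 (Matrix.of fun i j : Fin 2 => if i.val + j.val + 1 = 2 then (1 : L) else 0)).Local v × (UnitaryGroup.cmDatum L 1 (Matrix.of fun i j : Fin 1 => if i.val + j.val + 1 = 1 then (1 : L) else 0)).Local v) ⧸ Subgroup.centralizer ({a} : Set ((UnitaryGroup.cmDatum L 2 (Matrix.of fun i j : Fin 2 => if i.val + j.val + 1 = 2 then (1 : L) else 0)).Local v × (UnitaryGroup.cmDatum L 1 (Matrix.of fun i j : Fin 1 => if i.val + j.val + 1 = 1 then (1 : L) else 0)).Local v)))]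
        [∀ a : ((UnitaryGroup.cmDatum L 2 (Matrix.of fun i j : Fin 2 => if i.val + j.val + 1 = 2 then (1 : L) else 0)).Local v × (UnitaryGroup.cmDatum L 1 (Matrix.of fun i j : Fin 1 => if i.val + j.val + 1 = 1 then (1 : L) else 0)).Local v), BorelSpace (((UnitaryGroup.cmDatum L 2 (Matrix.of fun i j : Fin 2 => if i.val + j.val + 1 = 2 then (1 : L) else 0)).Local v × (UnitaryGroup.cmDatum L 1 (Matrix.of fun i j : Fin 1 => if i.val + j.val + 1 = 1 then (1 : L) else 0)).Local v) ⧸ Subgroup.centralizer ({a} : Set ((UnitaryGroup.cmDatum L 2 (Matrix.of fun i j : Fin 2 => if i.val + j.val + 1 = 2 then (1 : L) else 0)).Local v × (UnitaryGroup.cmDatum L 1 (Matrix.of fun i j : Fin 1 => if i.val + j.val + 1 = 1 then (1 : L) else 0)).Local v)))]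
        (νH : Measure ((UnitaryGroup.cmDatum L 2 (Matrix.of fun i j : Fin 2 => if i.val + j.val + 1 = 2 then (1 : L) else 0)).Local v × (UnitaryGroup.cmDatum L 1 (Matrix.of fun i j : Fin 1 => if i.val + j.val + 1 = 1 then (1 : L) else 0)).Local v)) [νH.IsHaarMeasure] [νH.IsMulRightInvariant]
        (νG₃ : Measure ((UnitaryGroup.cmDatum L 3 (Matrix.of fun i j : Fin 3 => if i.val + j.val + 1 = 3 then (1 : L) else 0)).Local v)) [νG₃.IsHaarMeasure] [νG₃.IsMulRightInvariant]
        (mH : OrbitalMeasureFamily ((UnitaryGroup.cmDatum L 2 (Matrix.of fun i j : Fin 2 => if i.val + j.val + 1 = 2 then (1 : L) else 0)).Local v × (UnitaryGroup.cmDatum L 1 (Matrix.of fun i j : Fin 1 => if i.val + j.val + 1 = 1 then (1 : L) else 0)).Local v)) (mG₃ : OrbitalMeasureFamily ((UnitaryGroup.cmDatum L 3 (Matrix.of fun i j : Fin 3 => if i.val + j.val + 1 = 3 then (1 : L) else 0)).Local v))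
        (_hmH : mH.IsCanonical (IsLocalGRegular L v) νH) (_hmG : mG₃.IsCanonical (fun γ => IsRegularElt (γ.val : GL (Fin 3) (UnitaryGroup.LocalRing L v))) νG₃),
                  (∃ V ∈ 𝓝 (1 : ((UnitaryGroup.cmDatum L 2 (Matrix.of fun i j : Fin 2 => if i.val + j.val + 1 = 2 then (1 : L) else 0)).Local v × (UnitaryGroup.cmDatum L 1 (Matrix.of fun i j : Fin 1 => if i.val + j.val + 1 = 1 then (1 : L) else 0)).Local v)), ∀ γH ∈ V, IsLocalGRegular L v γH →
      ¬ (∃ x : (w.1.adicCompletion L), (((((γH).1.val : GL (Fin 2) (UnitaryGroup.LocalRing L v)).val.map (Pi.evalRingHom (fun w' : UnitaryGroup.PlacesOver L v => w'.1.adicCompletion L) w))).charpoly).IsRoot x) →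
      ∀ δp δm : ((UnitaryGroup.cmDatum L 3 (Matrix.of fun i j : Fin 3 => if i.val + j.val + 1 = 3 then (1 : L) else 0)).Local v), IsLocalNormPair L (Matrix.of fun i j : Fin 3 => if i.val + j.val + 1 = 3 then (1 : L) else 0) v γH δp → finKappaAt L v (Matrix.of fun i j : Fin 3 => if i.val + j.val + 1 = 3 then (1 : L) else 0) γH δp = 1 → IsLocalNormPair L (Matrix.of fun i j : Fin 3 => if i.val + j.val + 1 = 3 then (1 : L) else 0) v γH δm → finKappaAt L v (Matrix.of fun i j : Fin 3 => if i.val + j.val + 1 = 3 then (1 : L) else 0) γH δm = -1 →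
        (transvPlusFixCount (galAdicCompletionMap (L := L) (IsCMField.complexConj L) hw) ϖ d (d % 2) (mstarOfRecord d) ((localNonsplitEquiv (IsCMField.complexConj L) (Matrix.of fun i j : Fin 3 => if i.val + j.val + 1 = 3 then (1 : L) else 0) (IsCMField.complexConj_ne_one L) w hw δp :
              ↥(unitaryGroupOfForm (galAdicCompletionMap (L := L) (IsCMField.complexConj L) hw) (placeForm (Matrix.of fun i j : Fin 3 => if i.val + j.val + 1 = 3 then (1 : L) else 0) w.1))) : GL (Fin 3) (w.1.adicCompletion L)) : ℤ) -
            (cleanMinusFixCount (galAdicCompletionMap (L := L) (IsCMField.complexConj L) hw) ϖ d (d % 2) (mstarOfRecord d) (mcOfRecord d) ((localNonsplitEquiv (IsCMField.complexConj L) (Matrix.of fun i j : Fin 3 => if i.val + j.val + 1 = 3 then (1 : L) else 0) (IsCMField.complexConj_ne_one L) w hw δp :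
              ↥(unitaryGroupOfForm (galAdicCompletionMap (L := L) (IsCMField.complexConj L) hw) (placeForm (Matrix.of fun i j : Fin 3 => if i.val + j.val + 1 = 3 then (1 : L) else 0) w.1))) : GL (Fin 3) (w.1.adicCompletion L)) : ℤ) =
          (transvPlusFixCount (galAdicCompletionMap (L := L) (IsCMField.complexConj L) hw) ϖ d (d % 2) (mstarOfRecord d) ((localNonsplitEquiv (IsCMField.complexConj L) (Matrix.of fun i j : Fin 3 => if i.val + j.val + 1 = 3 then (1 : L) else 0) (IsCMField.complexConj_ne_one L) w hw δm :
              ↥(unitaryGroupOfForm (galAdicCompletionMap (L := L) (IsCMField.complexConj L) hw) (placeForm (Matrix.of fun i j : Fin 3 => if i.val + j.val + 1 = 3 then (1 : L) else 0) w.1))) : GL (Fin 3) (w.1.adicCompletion L)) : ℤ) -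
            (cleanMinusFixCount (galAdicCompletionMap (L := L) (IsCMField.complexConj L) hw) ϖ d (d % 2) (mstarOfRecord d) (mcOfRecord d) ((localNonsplitEquiv (IsCMField.complexConj L) (Matrix.of fun i j : Fin 3 => if i.val + j.val + 1 = 3 then (1 : L) else 0) (IsCMField.complexConj_ne_one L) w hw δm :
              ↥(unitaryGroupOfForm (galAdicCompletionMap (L := L) (IsCMField.complexConj L) hw) (placeForm (Matrix.of fun i j : Fin 3 => if i.val + j.val + 1 = 3 then (1 : L) else 0) w.1))) : GL (Fin 3) (w.1.adicCompletion L)) : ℤ)) := by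
  intro L _ _ _ v w hw he h2 ϖ hϖ d tE hD _ δ₀ _hδ₀ _hδ₀0 μ _hμu _hμω _ _ _ _ _ _ _ _ νH _ _ νG₃ _ _ mH mG₃ _hmH _hmG
  classical
  obtain ⟨VA, hVA, hA⟩ := F0P3cDyRamTypeTwoOppositeLiteralWild.exists_oppositeLiteral_wild L w hw he hD
  obtain ⟨VL, hVL, hL⟩ := hLit L w hw he h2 ϖ hϖ d tE hD
  refine ⟨VA ∩ VL, Filter.inter_mem hVA hVL, fun γH hγ hreg hirr δp δm hδp hκp hδm hκm => ?_⟩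
  obtain ⟨hγA, hγL⟩ := hγ
  -- `ι_w` as a homomorphism
  let ι : ((UnitaryGroup.cmDatum L 3 (Matrix.of fun i j : Fin 3 => if i.val + j.val + 1 = 3 then (1 : L) else 0)).Local v) →* GL (Fin 3) (w.1.adicCompletion L) :=
    (Subgroup.subtype _).comp (localNonsplitEquiv (IsCMField.complexConj L) (Matrix.of fun i j : Fin 3 => if i.val + j.val + 1 = 3 then (1 : L) else 0) (IsCMField.complexConj_ne_one L) w hw).toMulEquiv.toMonoidHom
  have hιe : ∀ x, ι x = ((localNonsplitEquiv (IsCMField.complexConj L) (Matrix.of fun i j : Fin 3 => if i.val + j.val + 1 = 3 then (1 : L) else 0) (IsCMField.complexConj_ne_one L) w hw x :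
        ↥(unitaryGroupOfForm (galAdicCompletionMap (L := L) (IsCMField.complexConj L) hw) (placeForm (Matrix.of fun i j : Fin 3 => if i.val + j.val + 1 = 3 then (1 : L) else 0) w.1))) : GL (Fin 3) (w.1.adicCompletion L)) := fun _ => rfl
  -- the signed pair and its exhaustion clauses (★ p847309 road)
  have hH : ((Matrix.of fun i j : Fin 3 => if i.val + j.val + 1 = 3 then (1 : L) else 0).map (cmConjRingHom L))ᵀ = (Matrix.of fun i j : Fin 3 => if i.val + j.val + 1 = 3 then (1 : L) else 0) := antidiagOne_isHermitian L 3
  have hdet : (Matrix.of fun i j : Fin 3 => if i.val + j.val + 1 = 3 then (1 : L) else 0).det ≠ 0 := (isUnit_antidiagOne_det L 3).ne_zero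
  obtain ⟨δp', δm', -, -, -, -, hexp, hexm, -⟩ :=
    exists_signedPair_finsum_delta_mul_classOrbitalIntegral_eq_mul_sub L (Matrix.of fun i j : Fin 3 => if i.val + j.val + 1 = 3 then (1 : L) else 0) hH hdet w hw μ
      (finExplicitDelta_conj_left_all L (Matrix.of fun i j : Fin 3 => if i.val + j.val + 1 = 3 then (1 : L) else 0) μ) (finExplicitDelta_conj_right_all L (Matrix.of fun i j : Fin 3 => if i.val + j.val + 1 = 3 then (1 : L) else 0) μ) hirr hδp
  have hu : IsUnit ((finCharpolyTwo L v γH).eval (finGammaTwo L v γH)) := isUnit_eval_finCharpolyTwo_of_isLocalGRegular L v γH hreg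
  -- the hyperbolic literal `t_h` (frame `A := 1`), of sign `+1`
  have hH'w : IsUnit (placeForm (Matrix.of fun i j : Fin 3 => if i.val + j.val + 1 = 3 then (1 : L) else 0) w.1) := isUnit_placeForm_antidiagOne (E := L) 3 w.1
  have hdet' : (placeForm (Matrix.of fun i j : Fin 3 => if i.val + j.val + 1 = 3 then (1 : L) else 0) w.1).det = -1 := by
    rw [placeForm_antidiagOne, F0P3cDyRamFixedPointCensusTypeTwoPrelude.antidiagonal_three_over_eq_block_antidiagonal_two, Matrix.det_fin_three]
    simp [StdForm.over, StdForm.antidiagonal_J_apply, Fin.rev]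
  have hframe : placeForm (Matrix.of fun i j : Fin 3 => if i.val + j.val + 1 = 3 then (1 : L) else 0) w.1 = (-(placeForm (Matrix.of fun i j : Fin 3 => if i.val + j.val + 1 = 3 then (1 : L) else 0) w.1).det) •
      formCongr (galAdicCompletionMap (L := L) (IsCMField.complexConj L) hw) (1 : GL (Fin 3) (w.1.adicCompletion L)) ((StdForm.antidiagonal 3).over (w.1.adicCompletion L)) := by
    rw [formCongr_one_eq, hdet', neg_neg, one_smul, placeForm_antidiagOne]
  have hyl : toPlace v w (1 : (v.adicCompletion ↥(maximalRealSubfield L))) = -(placeForm (Matrix.of fun i j : Fin 3 => if i.val + j.val + 1 = 3 then (1 : L) else 0) w.1).det := by rw [map_one, hdet', neg_neg]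
  obtain ⟨th, hth, hmat⟩ := exists_isLocalNormPair_coe_eq_of_frame L (Matrix.of fun i j : Fin 3 => if i.val + j.val + 1 = 3 then (1 : L) else 0) w hw hH'w 1 hframe γH
  have hκh : finKappaAt L v (Matrix.of fun i j : Fin 3 => if i.val + j.val + 1 = 3 then (1 : L) else 0) γH th = 1 := by
    rw [finKappaAt_eq_hilbertSymbol_of_coe_eq_of_frame L (Matrix.of fun i j : Fin 3 => if i.val + j.val + 1 = 3 then (1 : L) else 0) w hw hH'w 1 hframe 1 hyl γH hu hth hmat, hilbertSymbol_one_left]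
  rw [inv_one, one_mul, mul_one] at hmat
  -- the anisotropic literal `t_a` (★ p857702), of sign `−1`
  obtain ⟨ta, P₁, dg, η, γ₁, hta, hκa, hA1, hA2, hA3, hA4, hA5, hA6, hA7, hA8, hA9⟩ := hA γH hγA hreg hirr
  -- the matches are conjugate to the literals of their signs
  have hcp : IsConj th δp := ((hexp th hth hκh).symm.trans (hexp δp hδp hκp))
  have hcm : IsConj ta δm := ((hexm ta hta hκa).symm.trans (hexm δm hδm hκm))
  rw [transvPlusFixCount_eq_of_isConj L w hw ϖ d (d % 2) (mstarOfRecord d) hcp, cleanMinusFixCount_eq_of_isConj L w hw ϖ d (d % 2) (mstarOfRecord d) (mcOfRecord d) hcp,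
    transvPlusFixCount_eq_of_isConj L w hw ϖ d (d % 2) (mstarOfRecord d) hcm, cleanMinusFixCount_eq_of_isConj L w hw ϖ d (d % 2) (mstarOfRecord d) (mcOfRecord d) hcm,
    hmat, hA1]
  -- the literal letter
  have hthU : ι th ∈ unitaryGroupOfForm (galAdicCompletionMap (L := L) (IsCMField.complexConj L) hw) (placeForm (Matrix.of fun i j : Fin 3 => if i.val + j.val + 1 = 3 then (1 : L) else 0) w.1) := by rw [hιe]; exact Subtype.coe_prop _
  have htaU : ι ta ∈ unitaryGroupOfForm (galAdicCompletionMap (L := L) (IsCMField.complexConj L) hw) (placeForm (Matrix.of fun i j : Fin 3 => if i.val + j.val + 1 = 3 then (1 : L) else 0) w.1) := by rw [hιe]; exact Subtype.coe_prop _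
  rw [hιe, hmat] at hthU
  rw [hιe, hA1] at htaU
  exact hL γH hγL hreg hirr P₁ dg η γ₁ hthU htaU hA2 hA3 hA4 hA5 hA6 hA7 hA8 hA9

end Summit.HodgeConjecture.HodgeConjecture.Cruxes.H413.F0P3cDyRamCleanSgnDiffTypeTwoOfLiterals

end
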